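import Summits.BirchSwinnertonDyer.BirchSwinnertonDyer.Theorems.SignedLowerHalvesSprungLowerDivisibilityAtThreeKatoSporadicLedgerLambda
import Literature.NumberTheory.EllipticCurves.Kim2025.FineOneSidedDivisibility
import Literature.NumberTheory.EllipticCurves.Sprung2012.SharpFlatColemanKatoZetaJoint
import Literature.NumberTheory.EllipticCurves.Sprung2017.SharpFlatPAdicLFunctionProofs
import HarnessLib

/-!
# Crux K1 `SprungLowerDivisibilityAtThree` (stmt-BirchSwinnertonDyer-19875), line `chromatic-common-zeros`: SOCKET β at the level of
# K1's PREDICATE — `SprungSharpFlatLowerDivisibility W 3 •` for BOTH colours of an X8 pair from ONE integer inequality λ(𝐇¹/Z) ≤ λ(X₀)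
# (`--supports` 19875 as helper; closes nothing; K_spor / K1 / leaf X8 / BSD are NOT proved here)

Cell `bsd-ssimc`, width seat `cruxlead-…-19875-w2` (g7); sequel of `…KatoSporadicLedgerLambda` (p650544/p650879). There the fine λ-budget
`lambdaInvariant 3 (I.H ⧸ Cs.Z) ≤ lambdaInvariant 3 Y.X` was shown to force Kato's fine inequality `ℓ_𝔭(I.H ⧸ Cs.Z) ≤ ℓ_𝔭 Y.X` at every
height-one `𝔭 ∌ 3`. At the one height-one prime containing `3` the zeta index VANISHES on class X8 (THEOREM B through the period unit:
some colour's Néron-normalised `G₀` lies in no height-one prime containing `3`, `stub_periodMu`; then the cap `k ≤ ℓ_𝔭 Λ/(G₀) = 0` of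
`…KatoSporadicLedger`). So under the budget `ℓ_𝔭(I.H ⧸ Cs.Z) ≤ ℓ_𝔭 Y.X` at EVERY height-one prime, i.e. (characteristic ideals determine and
are determined by height-one lengths, `Kim2025.charIdeal_le_charIdeal_of_lengthAt_le`) `char Y.X ⊆ char (I.H ⧸ Cs.Z)` — the Eisenstein half
of Kato's Conj. 12.10 read on the package, which is exactly the displayed input of the tree door
`ChromaticCommonZeros.sprungSharpFlatLowerDivisibility_of_katoFineInclusion` (p622763). Hence:

* `ClassX8.fineCharIdeal_le_zetaCharIdeal_of_lambdaBudget (h714) (h716) (h3)`: on an X8 pair with joint packages `Cs, Cf` (`Cs.Z = Cf.Z`),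
  the budget for `Y` gives `Module.charIdeal Λ Y.X ≤ Module.charIdeal Λ (I.H ⧸ Cs.Z)`.
* `ClassX8.sprungSharpFlatLowerDivisibility_of_lambdaBudget (h714) (h716) (h3) (hJ)`: **`SprungSharpFlatLowerDivisibility W p col` for EITHER
  colour from the budget asked for every cyclotomic/Honda/newform frame, every pinned `I`, every joint package pair and every fine dual `Y`**
  (the frame-universal form is forced by K1's own binders; the budget itself is ONE integer per pair).

HONEST FRAMING (STUB-PLAN β4): the budget is IMC-λ on X8 — not weaker than K_spor ∧ S4b jointly; its merit is SHAPE. CONDITIONAL on the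
displayed named facts `h714`, `h716`, `h3`, `hJ` (joint package). Nothing here proves the budget for any curve.

References: [Kato2004Asterisque] Conj. 12.10 (p. 224), §17.13 (p. 280); [Sprung2012] Prop. 6.14, Thm. 7.14, Thm. 7.16, Prop. 7.19, Main Conj. 7.21;
[GreenbergVatsal2000] Rem. 3.4 and p. 4; [Washington1997] §13.2; tree: `…KatoSporadicLedgerLambda`, `…OfKatoMainIdentity`, `…StubPeriodMu`,
`Kim2025/FineOneSidedDivisibility` (`charIdeal_le_charIdeal_of_lengthAt_le`).
-/

set_option linter.dupNamespace false
set_option autoImplicit false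

noncomputable section

open scoped Classical NumberField MatrixGroups ModularForm

open NumberField IsDedekindDomain CongruenceSubgroup WeierstrassCurve Field
  Literature.NumberTheory.EllipticCurves Literature.NumberTheory.EllipticCurves.ModularForms
  Literature.NumberTheory.EllipticCurves.ZpExtension Literature.NumberTheory.EllipticCurves.Sprung2017
  Literature.NumberTheory.EllipticCurves.Sprung2012 Literature.NumberTheory.EllipticCurves.Rank1Residual
  Literature.NumberTheory.EllipticCurves.IwasawaAlgebra Literature.NumberTheory.EllipticCurves.Kato2004
  Literature.NumberTheory.EllipticCurves.Module
  Summit.BirchSwinnertonDyer.BirchSwinnertonDyer.Theorems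
  Summit.BirchSwinnertonDyer.BirchSwinnertonDyer.Theorems.SmallImageSignedMuDefect

namespace Summit.BirchSwinnertonDyer.BirchSwinnertonDyer.Theorems.ChromaticCommonZeros

/-- **The budget gives Kato's fine INCLUSION on the package.** In the setting of Sprung 2012 Thm. 2.2 on an X8 pair, for a newform `f`,
period ratio `ϖ`, Sprung pair, pinned `I` with joint packages `Cs, Cf` (`Cs.Z = Cf.Z`) and a fine dual `Y`: if
`lambdaInvariant p (I.H ⧸ Cs.Z) ≤ lambdaInvariant p Y.X` then `char Y.X ⊆ char (I.H ⧸ Cs.Z)` — off `(3)` by the λ-budget door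
(`ClassX8.katoFineLower_offThree_of_lambdaBudget`), at the prime above `3` because the zeta index vanishes there on X8 (THEOREM B via the
period unit `h3`), assembled by `Kim2025.charIdeal_le_charIdeal_of_lengthAt_le`. CONDITIONAL on `h714`, `h716`, `h3`.
[cite: Kato2004Asterisque, Conj. 12.10 (p. 224)] [cite: GreenbergVatsal2000, Rem. 3.4 and p. 4] [cite: Washington1997, §13.2] -/
theorem ClassX8.fineCharIdeal_le_zetaCharIdeal_of_lambdaBudget (h714 : thm714_sharpFlatSelmerDual_finite_torsion)
    (h716 : thm716_sharpFlatCharIdeal_divisibility) (h3 : realPeriodRat_eq_unit_mul_plusPeriod_three)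
    (W : WeierstrassCurve ℚ) [W.IsElliptic] [W.IsGloballyMinimal] (p : ℕ) [Fact p.Prime]
    [ContinuousSMul ℤ_[p] (W.tateModule p)] [Module.Free ℤ_[p] (W.tateModule p)]
    [Module.Finite ℤ_[p] (W.tateModule p)]
    (hX : ClassX8 W p) (κ : ZpExtension ℚ p) (γ : Field.absoluteGaloisGroup ℚ)
    (hκ : κ.IsCyclotomic) (hγ : κ.IsTopGenerator γ) (hcv : IsCyclotomicVariable p γ)
    (v : HeightOneSpectrum (𝓞 ℚ)) (hv : (p : 𝓞 ℚ) ∈ v.asIdeal)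
    (g : Field.absoluteGaloisGroup (v.adicCompletion ℚ))
    (hg : κ.IsTopGenerator (resGalOfEmb (closureEmb (K := ℚ) (v.adicCompletion ℚ)) g))
    (cneg : localPoints W (v.adicCompletion ℚ)) (c : ℕ → localPoints W (v.adicCompletion ℚ))
    (hH : IsHondaSystem κ (closureEmb (K := ℚ) (v.adicCompletion ℚ)) W (W.frobeniusTrace p) g cneg c)
    (N : ℕ) (hN : NeZero N) (f : CuspForm (Gamma0 N) 2) (ϖ : ℚ) (Lsharp Lflat : IwasawaAlgebra p)
    (hf : IsNewformOf W f) (hϖ : (ϖ : ℝ) * W.realPeriodRat = plusPeriod f)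
    (hSP : IsSprungPair f p (W.frobeniusTrace p) Lsharp Lflat)
    (I : Kato2004.IwasawaH1Data W p κ γ)
    (Cs : SharpFlatColemanKatoData W p f ϖ κ γ (closureEmb (K := ℚ) (v.adicCompletion ℚ)) (W.frobeniusTrace p) g c
      Chroma.sharp I)
    (Cf : SharpFlatColemanKatoData W p f ϖ κ γ (closureEmb (K := ℚ) (v.adicCompletion ℚ)) (W.frobeniusTrace p) g c
      Chroma.flat I)
    (hZ : Cs.Z = Cf.Z) (Y : W.FineSelmerDualData κ γ)
    (hbudget : lambdaInvariant p (I.H ⧸ Cs.Z) ≤ lambdaInvariant p Y.X) :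
    Module.charIdeal (IwasawaAlgebra p) Y.X ≤ Module.charIdeal (IwasawaAlgebra p) (I.H ⧸ Cs.Z) := by
  haveI : NeZero N := hN
  have hX' := hX
  obtain ⟨hp3, ⟨hgood, hap⟩, -⟩ := id hX
  subst hp3
  have hp2 : (3 : ℕ) ≠ 2 := by decide
  have hirr : W.HasIrreducibleModPGaloisRep 3 :=
    hasIrreducibleModPGaloisRep_of_dvd_frobeniusTrace W 3 hp2
      (W.not_dvd_minimalDiscriminantInt_of_hasGoodReductionAtPrime' 3 hgood) hap
  have hϖ0 : ϖ ≠ 0 := hf.periodRatio_ne_zero hϖ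
  obtain ⟨hGall, col₀, G₀, hG₀, hμ⟩ := stub_periodMu h3 W 3 hX' N hN f ϖ Lsharp Lflat hf hϖ hSP
  -- the `μ = 0` colour is non-zero: otherwise `G₀ = 0` would lie in the height-one prime `(3)`
  haveI : (augIdealP 3).IsPrime := isPrime_augIdealP_holds 3
  have hcol₀ : chromaticL col₀ Lsharp Lflat ≠ 0 := by
    intro h0
    have hG00 : G₀ = 0 := iwasawaToPowerSeries_injective 3 (by rw [hG₀, h0, map_zero, mul_zero])
    refine hμ ⟨augIdealP 3, inferInstance⟩ (height_augIdealP_holds 3) ?_ (by rw [hG00]; exact Ideal.zero_mem _)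
    change ((3 : ℕ) : IwasawaAlgebra 3) ∈ Ideal.span {PowerSeries.C ((3 : ℕ) : ℤ_[3])}
    rw [← map_natCast (PowerSeries.C (R := ℤ_[3])) 3]
    exact Ideal.mem_span_singleton_self _
  have hG₀0 : G₀ ≠ 0 := by
    intro h0
    rw [h0, map_zero, eq_comm, mul_eq_zero] at hG₀
    rcases hG₀ with hC | hL
    · have h1 : ((ϖ : ℚ) : ℚ_[3]) = 0 := by simpa using congrArg PowerSeries.constantCoeff hC
      exact hϖ0 (by exact_mod_cast h1)
    · exact hcol₀ (iwasawaToPowerSeries_injective 3 (by rw [hL, map_zero]))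
  -- finiteness / torsion of `I.H ⧸ Cs.Z` and `Y.X` through the package of the non-zero colour `col₀`
  have key : ∀ (C₀ : SharpFlatColemanKatoData W 3 f ϖ κ γ (closureEmb (K := ℚ) (v.adicCompletion ℚ))
        (W.frobeniusTrace 3) g c col₀ I), C₀.Z = Cs.Z →
      Module.charIdeal (IwasawaAlgebra 3) Y.X ≤ Module.charIdeal (IwasawaAlgebra 3) (I.H ⧸ Cs.Z) := by
    intro C₀ hZ₀
    obtain ⟨D⟩ := nonempty_sharpFlatSelmerDualData_rat W κ γ v g c col₀
    obtain ⟨hfin, hXt⟩ := h714 W 3 hp2 hgood hap f hf κ γ hκ hγ hcv v hv g hg cneg c hH col₀ Lsharp Lflat hSP hcol₀ D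
    haveI := hfin
    haveI := C₀.moduleFinite_H W 3 hSP hcol₀
    haveI := C₀.moduleFinite_fine W 3 D Y
    have hYt := C₀.isTorsion_fine W 3 D hXt Y
    have hQt : Module.IsTorsion (IwasawaAlgebra 3) (I.H ⧸ Cs.Z) := by
      rw [← hZ₀]; exact C₀.isTorsion_quotient_zeta W 3 hirr hSP hcol₀ hG₀ hG₀0
    refine Kim2025.charIdeal_le_charIdeal_of_lengthAt_le hYt hQt fun 𝔭 h𝔭 => ?_
    by_cases h3𝔭 : ((3 : ℕ) : IwasawaAlgebra 3) ∈ 𝔭.asIdeal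
    · -- at the prime above `3`: the zeta index vanishes (THEOREM B)
      have hcap := C₀.lengthAt_quotient_zeta_le_lengthAt_quotient_span W 3 hirr hSP hcol₀ hG₀ 𝔭 h𝔭
      rw [hZ₀, lengthAt_quotient_eq_zero_of_not_le (I := Ideal.span {G₀})
        (by rw [Ideal.span_singleton_le_iff_mem]; exact hμ 𝔭 h𝔭 h3𝔭)] at hcap
      exact hcap.trans bot_le
    · exact ClassX8.katoFineLower_offThree_of_lambdaBudget h714 h716 h3 W 3 hX' κ γ hκ hγ hcv v hv g hg cneg c hH N hN f ϖ
        Lsharp Lflat hf hϖ hSP I Cs Cf hZ Y hbudget 𝔭 h𝔭 h3𝔭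
  cases col₀ with
  | sharp => exact key Cs rfl
  | flat => exact key Cf hZ.symm

/-- **K1's PREDICATE FROM THE λ-BUDGET (socket β at the level of `SprungSharpFlatLowerDivisibility`).** On an X8 pair, for EITHER colour
`•`: if for every cyclotomic/Honda/newform frame of Sprung 2012 Thm. 2.2, every pinned `I = 𝐇¹_Γ(T_3W)`, every JOINT ♯/♭ package pair
`Cs, Cf` (`Cs.Z = Cf.Z`) and every fine dual `Y` the ONE integer inequality `lambdaInvariant 3 (I.H ⧸ Cs.Z) ≤ lambdaInvariant 3 Y.X` holds
(«λ of the zeta index ≤ λ(X₀(E/ℚ_∞))»), then `SprungSharpFlatLowerDivisibility W p •` — the ♯/♭ Eisenstein divisibility of crux K1 for this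
pair and colour. Route: joint packages from `hJ`, the fine inclusion from the previous theorem, then the tree door
`sprungSharpFlatLowerDivisibility_of_katoFineInclusion` (p622763). CONDITIONAL on `h714`, `h716`, `h3`, `hJ` (displayed); the budget is the
(open, IMC-λ-strength) input. [cite: Sprung2012, Prop. 7.19 and Main Conj. 7.21 (p. 1505), Thm. 7.14, Thm. 7.16 (p. 1504)]
[cite: Kato2004Asterisque, Conj. 12.10 (p. 224)] [cite: GreenbergVatsal2000, p. 4] -/
theorem ClassX8.sprungSharpFlatLowerDivisibility_of_lambdaBudget (h714 : thm714_sharpFlatSelmerDual_finite_torsion)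
    (h716 : thm716_sharpFlatCharIdeal_divisibility) (h3 : realPeriodRat_eq_unit_mul_plusPeriod_three)
    (hJ : thm714seq_sharpFlatColemanKato_zetaJoint)
    (W : WeierstrassCurve ℚ) [W.IsElliptic] [W.IsGloballyMinimal] (p : ℕ) [Fact p.Prime] (hX : ClassX8 W p) (col : Chroma)
    (hbudget : ∀ [ContinuousSMul ℤ_[p] (W.tateModule p)] [Module.Free ℤ_[p] (W.tateModule p)]
        [Module.Finite ℤ_[p] (W.tateModule p)] (κ : ZpExtension ℚ p) (γ : Field.absoluteGaloisGroup ℚ),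
        κ.IsCyclotomic → κ.IsTopGenerator γ → IsCyclotomicVariable p γ →
      ∀ (v : HeightOneSpectrum (𝓞 ℚ)), (p : 𝓞 ℚ) ∈ v.asIdeal →
      ∀ (g : Field.absoluteGaloisGroup (v.adicCompletion ℚ)),
        κ.IsTopGenerator (resGalOfEmb (closureEmb (K := ℚ) (v.adicCompletion ℚ)) g) →
      ∀ (cneg : localPoints W (v.adicCompletion ℚ)) (c : ℕ → localPoints W (v.adicCompletion ℚ)),
        IsHondaSystem κ (closureEmb (K := ℚ) (v.adicCompletion ℚ)) W (W.frobeniusTrace p) g cneg c →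
      ∀ (N : ℕ) (_ : NeZero N) (f : CuspForm (Gamma0 N) 2) (ϖ : ℚ),
        IsNewformOf W f → (ϖ : ℝ) * W.realPeriodRat = plusPeriod f →
      ∀ (I : Kato2004.IwasawaH1Data W p κ γ)
        (Cs : SharpFlatColemanKatoData W p f ϖ κ γ (closureEmb (K := ℚ) (v.adicCompletion ℚ)) (W.frobeniusTrace p) g c
          Chroma.sharp I)
        (Cf : SharpFlatColemanKatoData W p f ϖ κ γ (closureEmb (K := ℚ) (v.adicCompletion ℚ)) (W.frobeniusTrace p) g c
          Chroma.flat I),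
        Cs.Z = Cf.Z → ∀ (Y : W.FineSelmerDualData κ γ),
        lambdaInvariant p (I.H ⧸ Cs.Z) ≤ lambdaInvariant p Y.X) :
    SprungSharpFlatLowerDivisibility W p col := by
  have hX' := hX
  obtain ⟨hp3, ⟨hgood, hap⟩, -⟩ := id hX
  subst hp3
  have hp2 : (3 : ℕ) ≠ 2 := by decide
  refine sprungSharpFlatLowerDivisibility_of_katoFineInclusion h714 h3 W 3 hX' col
    fun κ γ hκ hγ hcv v hv g hg cneg c hH N hN f ϖ hf hϖ I Y => ?_
  haveI : NeZero N := hN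
  obtain ⟨Cs, Cf, hZ⟩ := hJ W 3 f ϖ κ γ hp2 hgood hap hf hϖ hκ hγ hcv v hv g hg cneg c hH I
  obtain ⟨Lsharp, Lflat, hSP⟩ := thm112_exists_isSprungPair_holds (W := W) (f := f) (p := 3) hp2 hf hgood hap
  have hle := ClassX8.fineCharIdeal_le_zetaCharIdeal_of_lambdaBudget h714 h716 h3 W 3 hX' κ γ hκ hγ hcv v hv g hg cneg c hH
    N hN f ϖ Lsharp Lflat hf hϖ hSP I Cs Cf hZ Y (hbudget κ γ hκ hγ hcv v hv g hg cneg c hH N hN f ϖ hf hϖ I Cs Cf hZ Y)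
  cases col with
  | sharp => exact ⟨Cs, hle⟩
  | flat => exact ⟨Cf, by rw [← hZ]; exact hle⟩

end Summit.BirchSwinnertonDyer.BirchSwinnertonDyer.Theorems.ChromaticCommonZeros

end
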